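import Literature.MathematicalPhysics.QuantumFieldTheory.Balaban1983to89.B12Sect4Statements
import Literature.MathematicalPhysics.QuantumFieldTheory.Balaban1983to89.B12Eq45LocalisedBlocks
import Literature.MathematicalPhysics.QuantumFieldTheory.Balaban1983to89.B2Lemma25Proof

/-!
# `Balaban1983to89.B12Term286DifferentBlocks` — T. Bałaban, *Renormalization group approach to lattice gauge field
theories. I. Generation of effective actions in a small field approximation and a coupling constant renormalization in
four dimensions*, Commun. Math. Phys. **109** (1987) 249–301 [Balaban1987RG1], p. 286: the DIFFERENT-BLOCKS term
estimate for the second sum of (4.21), with the p. 282 block hypotheses DISCHARGED from analyticity of `𝐇_j(□₀,·)` and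
the first-order localisation bound

statement-level skeleton of published theorems with citation tags; proofs where landed; nothing here is a claim about
the Yang–Mills mass gap

PDF held: `paper:balaban1987-cmp109-rg-i-small-field` (journal page = PDF page + 248); p. 286 [PDF 38] and p. 282
[PDF 34] read as images from
`run/shared/lean/pub/pub-balaban/b2b-balaban-ref1/pages/1987-cmp109-rg-I-small-field/1987-cmp109-rg-I-small-field-p038-x2.png`
and `…-p034-x2.png`.

CITATION HEADER / WHAT IS REPRODUCED (mega-formalization `lit-balaban`, HOME `run/shared/lean/pub/lit-balaban/`; unit
`lit-balaban-r20` = fold owner of B12–B16, generation 11; SKELETON rows `B12.Eq4.21-4.22` (shared id; r20 file of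
record `B12Sect4Statements`, p239748) and `B12.Txt@286a` (r09 display row); free-target protocol G.5-34(d)).

p. 286 [PDF 38], verbatim: *"The second case is more complicated, the points x, x₃ are connected with different sets
in a partition, and we apply the identities (4.3) with localizations at the points x, x₃ fixed, i.e. with the
summations over x, x₃ left undone. A term corresponding to such a partition can be estimated by
  Σ_{x,x₃} (8B₃ (1/α₂))⁴ E₀ exp(−κd_j(X) − δ₀ dist^{(ξ)}(X, x) − δ₀ dist^{(ξ)}(X, x₃)) |B|² |δB(x)| |(∂B)(Γ_{x,x₃})|"*.
The inputs, p. 282 [PDF 34], verbatim: *"The norm in (4.4) of the expression ⟨δ^{n(p)}/δB^{n(p)} 𝐇_j(□₀, 0),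
⊗_{i∈N(p)} B_i⟩ can be estimated by B₃ Π_{i∈N(p)} |B_i|, and if one of the functions B_i is localized outside the
domain X, then we have the additional exponential factor exp(−δ₀ dist^{(ξ)}(X, supp B_i))."* (v1.3: quotation
re-read on the render and corrected to the verbatim wording; v1–v1.2 carried a paraphrase inside the quotation marks)
— in [15] these are Proposition 9 (analyticity of `𝐇_j(□₀, ·)`, `𝐇_j(□₀, 0) = 0`) and the (190)-type first-order
localisation bound; together with the analyticity (4.4) p. 281 and the bound (1.18) p. 263 for the outer function
`𝐀 ↦ 𝐄^{(j)}(X, exp iξ𝐀)`.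

WHAT THIS MODULE DOES (imports r20's `B12Sect4Statements` — `PointData286`, `PointData286.lhsSummand`,
`differentBlocks_term_le`, `termEstimate286_of_pointwise`, `TermEstimate286Printed` — and p05 g8's
`B12Eq45LocalisedBlocks` / `B12Eq45BlockBound` — `norm_blockIns_le_localised`, `norm_blockIns_le_uniform` — over
pv12's `B12Repr43.blockIns` / `blockSet` and `B12Ineq45.dirIter`; modifies nothing; THEOREMS ONLY, no definition, no
new named fact).

r20's `B12Sect4Statements.differentBlocks_term_le` (gen 1) proved the p. 286 different-blocks term estimate from
pv12's `B12Ineq45.term_bound_pair` with the p. 282 block bounds as the HYPOTHESIS `hv` — `‖v_p‖ ≤ w_p · B₃ Π_{i∈N(p)}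
size_i` for abstract directions `v_p`, weights `w_{p₀} ≤ e^{−δ₀dist(X,x)}`, `w_{p₁} ≤ e^{−δ₀dist(X,x₃)}` on the two
blocks of the localised arguments.  Here the directions are THE ACTUAL (4.3) insertions
`v_p = ⟨δ^{n(p)}𝐇(0), ⊗_{i∈N(p)}B_i⟩ = blockIns H 0 B c p` of a partition `c` (Mathlib `OrderedFinpartition 4`) of the
four arguments of the second sum of (4.21) — `B_0 = δB_μ(x)` (localised at `x`), `B_1 = B_{μ₁}`, `B_2 = B_{μ₂}`,
`B_3 = (∂B_{μ₃})(Γ_{x,x₃})` (localised at `x₃`) — and `hv` is DISCHARGED from the printed inputs only: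

* `term286_blockIns_le` — for every block `p` of `c`: `‖v_p‖ ≤ w_p · B₃ Π_{i∈N(p)} size_i` with
  `w_p = e^{−δ₀dist^{(ξ)}(X,x)}` if `N(p) ∋ 0`, `= e^{−δ₀dist^{(ξ)}(X,x₃)}` if `N(p) ∋ 3` but not `0`, `= 1` otherwise, for
  any `B₃ ≥ max{S_H, K}·max{1, 8/a}⁴`, from: `H = 𝐇_j(□₀,·)` analytic on an open `U_W ⊇ {‖·‖ < a}` with sup `S_H`
  (Prop. 9 [15]) and the first-order localisation bounds `‖δ𝐇(y)[B_0]‖ ≤ e^{−δ₀dist(X,x)}·K·‖B_0‖`,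
  `‖δ𝐇(y)[B_3]‖ ≤ e^{−δ₀dist(X,x₃)}·K·‖B_3‖` on that ball ((190)-shape, p. 282) — p05's `norm_blockIns_le_localised`
  (used twice) and `norm_blockIns_le_uniform`;
* **`term286_differentBlocks_le`** — THE p. 286 SENTENCE FOR ONE TERM: if `x` and `x₃` *"are connected with
  different sets in a partition"* (`c.index 0 ≠ c.index 3`), then
  `‖∂_{v_r}⋯∂_{v_1}𝐄(0)‖ ≤ lhsSummand x x₃ = (8B₃α₂⁻¹)⁴E₀e^{−κd_j(X) − δ₀dist^{(ξ)}(X,x) − δ₀dist^{(ξ)}(X,x₃)}|B|²|δB(x)||(∂B)(Γ_{x,x₃})|`,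
  the outer `𝐄 = 𝐀 ↦ 𝐄^{(j)}(X, exp iξ𝐀)` analytic on an open `U ⊇ {‖𝐀‖ < α₂}` ((4.4)) with `‖𝐄‖ ≤ E₀e^{−κd_j(X)}`
  there ((1.18)), sizes `‖B_0‖ ≤ |δB(x)|`, `‖B_1‖, ‖B_2‖ ≤ |B|`, `‖B_3‖ ≤ |(∂B)(Γ_{x,x₃})|`, `8B₃ ≥ α₂`;
* `norm_iteratedFDeriv_term286_le` — the same for the term written, as in (4.3), as the Fréchet derivative
  `D^{|c|}𝐄(0)[v_1,…,v_r]` (pv12 `B12Repr43.iteratedFDeriv_apply_eq_dirIter`);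
* `termEstimate286_differentBlocks` — *"A term corresponding to such a partition can be estimated by Σ_{x,x₃}(…)"*:
  r20's display-shape `TermEstimate286Printed D termQ` for `termQ x x₃ :=` the `c`-term with the `(x, x₃)`-localised
  arguments, from the pointwise bound (`termEstimate286_of_pointwise`).

HONEST SCOPE.  (1) Only the DIFFERENT-BLOCKS case of p. 286 is treated; the same-block case (*"the exponential factor,
with a length of a shortest tree graph in the exponent, yields the factor exp(−δ₀|x₃ − x|)"*) is the by-reference
input of [15] Sect. G for several localized arguments in ONE block (r20's hypothesis shape
`SameBlockFactor286Printed`; cell GAPS G-B11-G2a) and is NOT touched — so the decl of record of row `B12.Eq4.21-4.22`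
(`KernelBound422Printed`, (4.22)) keeps its inputs and the row head does not move.  (2) The constant: print's `B₃` is
the constant of [15]; here any `B₃ ≥ max{S_H, K}·max{1, 8/a}⁴` works — the Cauchy-estimate constant of p05's route
(Prop. 9 analyticity + Cauchy estimates instead of the Sect. G tree expansion; same shape, cf. `B12Eq45BlockBound`
HONEST SCOPE).  (3) The localisation of `B_0` at `x` and of `B_3` at `x₃` enters only through the two first-order
bounds (hypotheses `hlocx`, `hlocx₃`, the (190)-shape of p. 282); the carrier `P` of the points `x, x₃` and the point
functions `dist^{(ξ)}(X,·)`, `|δB(·)|`, `|(∂B)(Γ_{·,·})|` are r20's abstract `PointData286`.  (4) `e^{−δ₀dist} ≤ 1`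
uses `δ₀·dist^{(ξ)}(X,·) ≥ 0` (hypotheses).  Every declaration below is a proved theorem; axioms standard.

v1.1 (same unit and generation, APPEND-ONLY §4 — *"Summing over x, x₃ we get finally the following estimate"*):
* `differentBlocks_summed_actual` — the second case END TO END for the actual (4.3) terms: with the p. 286 display
  (r20's `Display286Printed`, a printed display taken by reference — its right member needs (4.17), the sizes of `B`,
  `δB` and the geometry behind *"δ₁ = O(M⁻¹)"*) and the lattice sums `c₀(δ₁)`, `c₁(δ₁)`:
  `‖Σ_{x,x₃} D^{|c|}𝐄(0)[v(c; x, x₃)]‖ ≤ (8B₃α₁α₂⁻¹)⁴E₀c₀c₁e^{−⅓κd_j(X)}(L^jη)⁵` (r20's `differentBlocks_summed_le`);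
* `secondSum_expansion` — (4.3) for the second sum of (4.21) with the `(x, x₃)`-summation outermost:
  `Σ_{x,x₃} D⁴(𝐄∘𝐇)(0)[B(x,x₃)] = Σ_c Σ_{x,x₃} D^{|c|}𝐄(0)[v(c; x, x₃)]` (pv12 `faaDiBruno_apply` + `Finset.sum_comm`);
* **`kernelBound422_actual`** — (4.22) (r20's decl of record `KernelBound422Printed`) for
  `lhs2 := ‖Σ_{x,x₃} D⁴(𝐄∘𝐇)(0)[δB(x), B, B, (∂B)(Γ_{x,x₃})]‖`, the DIFFERENT-BLOCKS terms derived as above and the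
  SAME-BLOCK terms BY REFERENCE (hypothesis `hsame` = the p. 286 first case / [15] Sect. G tree decay for several
  localized arguments in one block, cell GAPS G-B11-G2a, stated as the same summed per-term bound), at most `4⁴`
  partitions (pv12 `card_orderedFinpartition_le_pow`), bookkeeping `E₀ ≤ 1 ≤ c₀c₁` (r20's `kernelBound422_of_terms`).
HONEST SCOPE (5): (4.22) is thus reached for the actual expansion MODULO exactly the printed by-reference inputs named
in `hsame` / `hD` / `hsum0` / `hsum1`; nothing of [15] Sect. G is proved here and the row head stays `typed`.

v1.2 (same unit and generation, APPEND-ONLY §5 — the lattice-sum constants of (4.22) made explicit; + import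
`B2Lemma25Proof` for the ℤ^ν decay sum `sum_exp_neg_l1dist_le`): `latticeSum_c0_le` (`Σ_x e^{−δ₁|x − x₀|₁} ≤ (1 + 2/δ₁)^ν`
for points located injectively on `ℤ^ν`), `latticeSum_c1_le` (`Σ_{x₃} e^{−δ₁|x₃ − x|₁}|x₃ − x|₁ ≤ (2/δ₁)(1 + 4/δ₁)^ν`),
**`kernelBound422_actual_l1`** (= `kernelBound422_actual` with `c₀(δ₁) := (1 + 2/δ₁)^ν`, `c₁(δ₁) := (2/δ₁)(1 + 4/δ₁)^ν`
and `hsum0`/`hsum1`/`1 ≤ c₀c₁` discharged for `0 < δ₁ ≤ 2`).  HONEST SCOPE (6): print's `|x − x₀|`, `|x₃ − x|` are read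
as the ℓ¹ lattice distance of located points (the model reading of `B2Lemma25Proof.l1dist`); print does not specify
the norm, and only names the constants through the symbol `c₀(δ₁)c₁(δ₁)`.
-/

noncomputable section

open Set Metric Finset
open scoped BigOperators

namespace Literature.MathematicalPhysics.QuantumFieldTheory.Balaban1983to89.B12Term286DifferentBlocks

open Literature.MathematicalPhysics.QuantumFieldTheory.Balaban1983to89
open B12Ineq45 B12Repr43 B12Sect4Statements B12Eq45BlockBound B12Eq45LocalisedBlocks

variable {P : Type*}
  {W : Type*} [NormedAddCommGroup W] [NormedSpace ℂ W]
  {E : Type*} [NormedAddCommGroup E] [NormedSpace ℂ E] [CompleteSpace E]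
  {F : Type*} [NormedAddCommGroup F] [NormedSpace ℂ F] [CompleteSpace F]

/-! ## §1. Blocks of an ordered partition: three bookkeeping facts -/

/-- [folklore] A position lies in exactly one block: membership of `i` in the block `N(p)` forces `p` to be the index
of `i`. -/
private theorem eq_index_of_mem_blockSet {n : ℕ} (c : OrderedFinpartition n) {p : Fin c.length} {i : Fin n}
    (h : i ∈ blockSet c p) : p = c.index i := by
  by_contra hne
  exact Finset.disjoint_left.1 (disjoint_blockSet c hne) h (mem_blockSet_index c i)

/-- [folklore] Membership in a block, read through its increasing parameterisation. -/
private theorem exists_emb_eq_of_mem_blockSet {n : ℕ} (c : OrderedFinpartition n) {p : Fin c.length} {i : Fin n}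
    (h : i ∈ blockSet c p) : ∃ q, c.emb p q = i := by
  obtain ⟨q, -, hq⟩ := Finset.mem_image.1 h
  exact ⟨q, hq⟩

/-- [folklore] Blocks of an ordered partition are nonempty. -/
private theorem blockSet_nonempty {n : ℕ} (c : OrderedFinpartition n) (p : Fin c.length) :
    (blockSet c p).Nonempty :=
  ⟨c.emb p ⟨0, c.partSize_pos p⟩, Finset.mem_image.2 ⟨⟨0, c.partSize_pos p⟩, Finset.mem_univ _, rfl⟩⟩

/-! ## §2. The p. 282 block bounds for the four arguments of (4.21), from analyticity + first-order localisation -/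

/-- **The p. 282 inputs of the p. 286 estimate, DISCHARGED.**  For the four arguments `B_0 = δB_μ(x)`, `B_1 = B_{μ₁}`,
`B_2 = B_{μ₂}`, `B_3 = (∂B_{μ₃})(Γ_{x,x₃})` of the second sum of (4.21) (sizes `|δB(x)|, |B|, |B|, |(∂B)(Γ_{x,x₃})|`),
an inner map `H` (`= 𝐇_j(□₀, ·)`, [15] Prop. 9) analytic on an open `U_W ⊇ {‖·‖ < a}` with `‖H‖ ≤ S_H` there, and the
first-order localisation bounds *"if one of the functions B_i is localized outside the domain X, then we have
the additional exponential factor exp(−δ₀ dist^{(ξ)}(X, supp B_i))"* for `B_0` (weight `e^{−δ₀dist^{(ξ)}(X,x)}`)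
and `B_3` (weight `e^{−δ₀dist^{(ξ)}(X,x₃)}`): every block insertion `⟨δ^{n(p)}H(0), ⊗_{i∈N(p)}B_i⟩` of every partition `c` is bounded by
`w_p · B₃ Π_{i∈N(p)} size_i`, `w_p` = the weight of `x` if `N(p) ∋ 0`, else the weight of `x₃` if `N(p) ∋ 3`, else `1`,
for any `B₃ ≥ max{S_H, K}·max{1, 8/a}⁴`, `B₃ ≥ 0`. [cite: Balaban1987RG1, p.282, p.286] -/
theorem term286_blockIns_le (D : PointData286 P) (x x₃ : P)
    {UW : Set W} (hUW : IsOpen UW) {a SH K : ℝ} (ha : 0 < a) (hballW : ball (0 : W) a ⊆ UW)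
    {H : W → E} (hH : AnalyticOnNhd ℂ H UW) (hSH : ∀ y ∈ ball (0 : W) a, ‖H y‖ ≤ SH) (hK : 0 ≤ K)
    (B : Fin 4 → W) (hB0 : ‖B 0‖ ≤ D.δB x) (hB1 : ‖B 1‖ ≤ D.normB) (hB2 : ‖B 2‖ ≤ D.normB)
    (hB3 : ‖B 3‖ ≤ D.dBΓ x x₃)
    (hlocx : ∀ y ∈ ball (0 : W) a, ‖fderiv ℂ H y (B 0)‖ ≤ Real.exp (-(D.δ₀ * D.distX x)) * (K * ‖B 0‖))
    (hlocx₃ : ∀ y ∈ ball (0 : W) a, ‖fderiv ℂ H y (B 3)‖ ≤ Real.exp (-(D.δ₀ * D.distX x₃)) * (K * ‖B 3‖))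
    (hB₃ : max SH K * (max 1 (2 * (4 : ℝ) / a)) ^ 4 ≤ D.B₃) (hB₃0 : 0 ≤ D.B₃)
    (c : OrderedFinpartition 4) (p : Fin c.length) :
    ‖blockIns (𝕜 := ℂ) H 0 B c p‖ ≤
      (if (0 : Fin 4) ∈ blockSet c p then Real.exp (-(D.δ₀ * D.distX x))
        else if (3 : Fin 4) ∈ blockSet c p then Real.exp (-(D.δ₀ * D.distX x₃)) else 1) *
        (D.B₃ * ∏ i ∈ blockSet c p, (![D.δB x, D.normB, D.normB, D.dBΓ x x₃] : Fin 4 → ℝ) i) := by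
  -- the four sizes dominate the four norms
  have hsz : ∀ i, ‖B i‖ ≤ (![D.δB x, D.normB, D.normB, D.dBΓ x x₃] : Fin 4 → ℝ) i := by
    intro i
    fin_cases i
    · simpa using hB0
    · simpa using hB1
    · simpa using hB2
    · simpa using hB3
  have hprod : ∏ q, ‖B (c.emb p q)‖ ≤
      ∏ i ∈ blockSet c p, (![D.δB x, D.normB, D.normB, D.dBΓ x x₃] : Fin 4 → ℝ) i := by
    rw [prod_blockSet c p]
    exact Finset.prod_le_prod (fun _ _ => norm_nonneg _) fun q _ => hsz _
  have hP0 : 0 ≤ ∏ q, ‖B (c.emb p q)‖ := Finset.prod_nonneg fun _ _ => norm_nonneg _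
  have hM0 : 0 ≤ (max 1 (2 * (4 : ℝ) / a)) ^ 4 := pow_nonneg (zero_le_one.trans (le_max_left _ _)) _
  have hKB : K * (max 1 (2 * (4 : ℝ) / a)) ^ 4 ≤ D.B₃ :=
    (mul_le_mul_of_nonneg_right (le_max_right SH K) hM0).trans hB₃
  have hSB : SH * (max 1 (2 * (4 : ℝ) / a)) ^ 4 ≤ D.B₃ :=
    (mul_le_mul_of_nonneg_right (le_max_left SH K) hM0).trans hB₃
  by_cases h0 : (0 : Fin 4) ∈ blockSet c p
  · -- the block of the `x`-localised argument `δB(x)`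
    rw [if_pos h0]
    obtain ⟨q, hq⟩ := exists_emb_eq_of_mem_blockSet c h0
    have h := norm_blockIns_le_localised hUW ha hballW hH B (fun i => i = 0) (Real.exp_nonneg _) hK
      (fun i hi y hy => by subst hi; exact hlocx y hy) c p ⟨q, hq⟩
    simp only [Nat.cast_ofNat] at h
    refine h.trans (mul_le_mul_of_nonneg_left ?_ (Real.exp_nonneg _))
    calc K * (max 1 (2 * (4 : ℝ) / a)) ^ 4 * ∏ q, ‖B (c.emb p q)‖
        ≤ D.B₃ * ∏ q, ‖B (c.emb p q)‖ := mul_le_mul_of_nonneg_right hKB hP0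
      _ ≤ D.B₃ * ∏ i ∈ blockSet c p, (![D.δB x, D.normB, D.normB, D.dBΓ x x₃] : Fin 4 → ℝ) i :=
          mul_le_mul_of_nonneg_left hprod hB₃0
  · rw [if_neg h0]
    by_cases h3 : (3 : Fin 4) ∈ blockSet c p
    · -- the block of the `x₃`-localised argument `(∂B)(Γ_{x,x₃})`
      rw [if_pos h3]
      obtain ⟨q, hq⟩ := exists_emb_eq_of_mem_blockSet c h3
      have h := norm_blockIns_le_localised hUW ha hballW hH B (fun i => i = 3) (Real.exp_nonneg _) hK
        (fun i hi y hy => by subst hi; exact hlocx₃ y hy) c p ⟨q, hq⟩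
      simp only [Nat.cast_ofNat] at h
      refine h.trans (mul_le_mul_of_nonneg_left ?_ (Real.exp_nonneg _))
      calc K * (max 1 (2 * (4 : ℝ) / a)) ^ 4 * ∏ q, ‖B (c.emb p q)‖
          ≤ D.B₃ * ∏ q, ‖B (c.emb p q)‖ := mul_le_mul_of_nonneg_right hKB hP0
        _ ≤ D.B₃ * ∏ i ∈ blockSet c p, (![D.δB x, D.normB, D.normB, D.dBΓ x x₃] : Fin 4 → ℝ) i :=
            mul_le_mul_of_nonneg_left hprod hB₃0
    · -- a block without localised arguments: the uniform bound
      rw [if_neg h3, one_mul]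
      have h := norm_blockIns_le_uniform hUW ha hballW hH hSH B c p
      simp only [Nat.cast_ofNat] at h
      calc ‖blockIns (𝕜 := ℂ) H 0 B c p‖
          ≤ SH * (max 1 (2 * (4 : ℝ) / a)) ^ 4 * ∏ q, ‖B (c.emb p q)‖ := h
        _ ≤ D.B₃ * ∏ q, ‖B (c.emb p q)‖ := mul_le_mul_of_nonneg_right hSB hP0
        _ ≤ D.B₃ * ∏ i ∈ blockSet c p, (![D.δB x, D.normB, D.normB, D.dBΓ x x₃] : Fin 4 → ℝ) i :=
            mul_le_mul_of_nonneg_left hprod hB₃0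

/-! ## §3. The p. 286 different-blocks term estimate with the block hypotheses discharged -/

/-- **p. 286, the second case, for ONE term of (4.3) — with the p. 282 block bounds DERIVED.**  *"… the points x, x₃
are connected with different sets in a partition … A term corresponding to such a partition can be estimated by
[(8B₃ (1/α₂))⁴ E₀ exp(−κd_j(X) − δ₀ dist^{(ξ)}(X, x) − δ₀ dist^{(ξ)}(X, x₃)) |B|² |δB(x)| |(∂B)(Γ_{x,x₃})|, summed
over x, x₃]"*.  Hypotheses, all printed inputs by reference: the outer function `𝐄 = 𝐀 ↦ 𝐄^{(j)}(X, exp iξ𝐀)`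
analytic on an open `U ⊇ {‖𝐀‖ < α₂}` ((4.4) p. 281) with `‖𝐄‖ ≤ E₀e^{−κd_j(X)}` there ((1.18) p. 263); the inner map
`H = 𝐇_j(□₀, ·)` analytic on an open `U_W ⊇ {‖·‖ < a}` with `‖H‖ ≤ S_H` ([15] Prop. 9); the sizes of the four
arguments of (4.21); the first-order localisation bounds of p. 282 for `δB(x)` and `(∂B)(Γ_{x,x₃})`;
`B₃ ≥ max{S_H, K}·max{1, 8/a}⁴`, `8B₃ ≥ α₂`, `δ₀dist ≥ 0`; and `x, x₃` in DIFFERENT blocks of the partition `c`.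
Conclusion: the `c`-term `∂_{v_r}⋯∂_{v_1}𝐄(0)`, `v_p = ⟨δ^{n(p)}𝐇(0), ⊗_{i∈N(p)}B_i⟩`, is at most the `(x, x₃)`
summand `lhsSummand x x₃` of the printed left member. [cite: Balaban1987RG1, p.286; (4.3)–(4.5) pp.281–282; (1.18) p.263] -/
theorem term286_differentBlocks_le (D : PointData286 P) (x x₃ : P)
    {U : Set E} (hU : IsOpen U) (hα : 0 < D.α₂) (hαB : D.α₂ ≤ 8 * D.B₃) (hball : ball (0 : E) D.α₂ ⊆ U)
    {f : E → F} (hf : AnalyticOnNhd ℂ f U)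
    (hS : ∀ y ∈ ball (0 : E) D.α₂, ‖f y‖ ≤ D.E₀ * Real.exp (-(D.κ * D.djX)))
    {UW : Set W} (hUW : IsOpen UW) {a SH K : ℝ} (ha : 0 < a) (hballW : ball (0 : W) a ⊆ UW)
    {H : W → E} (hH : AnalyticOnNhd ℂ H UW) (hSH : ∀ y ∈ ball (0 : W) a, ‖H y‖ ≤ SH) (hK : 0 ≤ K)
    (B : Fin 4 → W) (hB0 : ‖B 0‖ ≤ D.δB x) (hB1 : ‖B 1‖ ≤ D.normB) (hB2 : ‖B 2‖ ≤ D.normB)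
    (hB3 : ‖B 3‖ ≤ D.dBΓ x x₃) (hδx : 0 ≤ D.δ₀ * D.distX x) (hδx₃ : 0 ≤ D.δ₀ * D.distX x₃)
    (hlocx : ∀ y ∈ ball (0 : W) a, ‖fderiv ℂ H y (B 0)‖ ≤ Real.exp (-(D.δ₀ * D.distX x)) * (K * ‖B 0‖))
    (hlocx₃ : ∀ y ∈ ball (0 : W) a, ‖fderiv ℂ H y (B 3)‖ ≤ Real.exp (-(D.δ₀ * D.distX x₃)) * (K * ‖B 3‖))
    (hB₃ : max SH K * (max 1 (2 * (4 : ℝ) / a)) ^ 4 ≤ D.B₃)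
    (c : OrderedFinpartition 4) (hc : c.index 0 ≠ c.index 3) :
    ‖dirIter c.length (fun p => blockIns (𝕜 := ℂ) H 0 B c (Fin.rev p)) f 0‖ ≤ D.lhsSummand x x₃ := by
  have hB₃0 : 0 ≤ D.B₃ := by linarith
  have h0mem : (0 : Fin 4) ∈ blockSet c (c.index 0) := mem_blockSet_index c 0
  have h3mem : (3 : Fin 4) ∈ blockSet c (c.index 3) := mem_blockSet_index c 3
  have h0not : (0 : Fin 4) ∉ blockSet c (c.index 3) := fun h => hc (eq_index_of_mem_blockSet c h).symm
  -- the weight of a block: that of `x` if it holds `δB(x)`, that of `x₃` if it holds `(∂B)(Γ_{x,x₃})`, else `1`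
  obtain ⟨wt, hwt0, hwt1, hw0, hw3, hins⟩ : ∃ wt : Fin c.length → ℝ, (∀ p, 0 ≤ wt p) ∧ (∀ p, wt p ≤ 1) ∧
      wt (c.index 0) = Real.exp (-(D.δ₀ * D.distX x)) ∧ wt (c.index 3) = Real.exp (-(D.δ₀ * D.distX x₃)) ∧
      ∀ p, ‖blockIns (𝕜 := ℂ) H 0 B c p‖ ≤
        wt p * (D.B₃ * ∏ i ∈ blockSet c p, (![D.δB x, D.normB, D.normB, D.dBΓ x x₃] : Fin 4 → ℝ) i) := by
    refine ⟨fun p => if (0 : Fin 4) ∈ blockSet c p then Real.exp (-(D.δ₀ * D.distX x))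
        else if (3 : Fin 4) ∈ blockSet c p then Real.exp (-(D.δ₀ * D.distX x₃)) else 1,
      fun p => ?_, fun p => ?_, ?_, ?_, fun p => ?_⟩
    · dsimp only
      split_ifs <;> positivity
    · dsimp only
      split_ifs
      · exact Real.exp_le_one_iff.2 (by linarith)
      · exact Real.exp_le_one_iff.2 (by linarith)
      · exact le_rfl
    · dsimp only
      rw [if_pos h0mem]
    · dsimp only
      rw [if_neg h0not, if_pos h3mem]
    · exact term286_blockIns_le D x x₃ hUW ha hballW hH hSH hK B hB0 hB1 hB2 hB3 hlocx hlocx₃ hB₃ hB₃0 c p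
  have hnormB : 0 ≤ D.normB := (norm_nonneg _).trans hB1
  have hδB : 0 ≤ D.δB x := (norm_nonneg _).trans hB0
  have hdBΓ : 0 ≤ D.dBΓ x x₃ := (norm_nonneg _).trans hB3
  have hp : Fin.rev (c.index 0) ≠ Fin.rev (c.index 3) := fun h => hc (Fin.rev_injective h)
  exact differentBlocks_term_le D x x₃ hU hα hαB hball hf.differentiableOn hS hnormB hδB hdBΓ
    (fun p => blockSet c (Fin.rev p))
    (fun p q hpq => disjoint_blockSet c fun h => hpq (Fin.rev_injective h))
    (biUnion_blockSet_comp_equiv c Fin.revPerm) (fun p => blockSet_nonempty c _)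
    (fun p => wt (Fin.rev p)) (fun p => hwt0 _) (fun p => hwt1 _) hp
    (by simp only [Fin.rev_rev, hw0, le_refl]) (by simp only [Fin.rev_rev, hw3, le_refl])
    (fun p => blockIns (𝕜 := ℂ) H 0 B c (Fin.rev p)) (fun p => hins _)

/-- **The same term written as in (4.3)**: the Fréchet derivative `D^{|c|}𝐄(0)[⟨δ^{n(p)}𝐇(0), ⊗_{i∈N(p)}B_i⟩_{p}]`
(pv12's `iteratedFDeriv_apply_eq_dirIter`: the (4.3) terms are iterated directional derivatives) is at most
`lhsSummand x x₃` under the hypotheses of `term286_differentBlocks_le`.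
[cite: Balaban1987RG1, p.286; (4.3) p.281] -/
theorem norm_iteratedFDeriv_term286_le (D : PointData286 P) (x x₃ : P)
    {U : Set E} (hU : IsOpen U) (hα : 0 < D.α₂) (hαB : D.α₂ ≤ 8 * D.B₃) (hball : ball (0 : E) D.α₂ ⊆ U)
    {f : E → F} (hf : AnalyticOnNhd ℂ f U)
    (hS : ∀ y ∈ ball (0 : E) D.α₂, ‖f y‖ ≤ D.E₀ * Real.exp (-(D.κ * D.djX)))
    {UW : Set W} (hUW : IsOpen UW) {a SH K : ℝ} (ha : 0 < a) (hballW : ball (0 : W) a ⊆ UW)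
    {H : W → E} (hH : AnalyticOnNhd ℂ H UW) (hSH : ∀ y ∈ ball (0 : W) a, ‖H y‖ ≤ SH) (hK : 0 ≤ K)
    (B : Fin 4 → W) (hB0 : ‖B 0‖ ≤ D.δB x) (hB1 : ‖B 1‖ ≤ D.normB) (hB2 : ‖B 2‖ ≤ D.normB)
    (hB3 : ‖B 3‖ ≤ D.dBΓ x x₃) (hδx : 0 ≤ D.δ₀ * D.distX x) (hδx₃ : 0 ≤ D.δ₀ * D.distX x₃)
    (hlocx : ∀ y ∈ ball (0 : W) a, ‖fderiv ℂ H y (B 0)‖ ≤ Real.exp (-(D.δ₀ * D.distX x)) * (K * ‖B 0‖))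
    (hlocx₃ : ∀ y ∈ ball (0 : W) a, ‖fderiv ℂ H y (B 3)‖ ≤ Real.exp (-(D.δ₀ * D.distX x₃)) * (K * ‖B 3‖))
    (hB₃ : max SH K * (max 1 (2 * (4 : ℝ) / a)) ^ 4 ≤ D.B₃)
    (c : OrderedFinpartition 4) (hc : c.index 0 ≠ c.index 3) :
    ‖iteratedFDeriv ℂ c.length f 0 (blockIns (𝕜 := ℂ) H 0 B c)‖ ≤ D.lhsSummand x x₃ := by
  have h0 : (0 : E) ∈ U := hball (mem_ball_self hα)
  rw [iteratedFDeriv_apply_eq_dirIter hU (hf.contDiffOn_of_completeSpace (n := c.length)) h0]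
  exact term286_differentBlocks_le D x x₃ hU hα hαB hball hf hS hUW ha hballW hH hSH hK B hB0 hB1 hB2 hB3 hδx hδx₃
    hlocx hlocx₃ hB₃ c hc

/-- **p. 286: *"A term corresponding to such a partition can be estimated by Σ_{x,x₃} (8B₃ (1/α₂))⁴ E₀ exp(−κd_j(X) −
δ₀ dist^{(ξ)}(X, x) − δ₀ dist^{(ξ)}(X, x₃)) |B|² |δB(x)| |(∂B)(Γ_{x,x₃})|"*** — r20's display-shape
`TermEstimate286Printed` (the term of a different-blocks partition `c`, *"with the summations over x, x₃ left
undone"*, summed in norm against the printed left member) for the ACTUAL (4.3) terms with the `(x, x₃)`-localised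
arguments `B x x₃`, every block hypothesis discharged: pointwise `norm_iteratedFDeriv_term286_le` +
`termEstimate286_of_pointwise`. [cite: Balaban1987RG1, p.286] -/
theorem termEstimate286_differentBlocks [Fintype P] (D : PointData286 P)
    {U : Set E} (hU : IsOpen U) (hα : 0 < D.α₂) (hαB : D.α₂ ≤ 8 * D.B₃) (hball : ball (0 : E) D.α₂ ⊆ U)
    {f : E → F} (hf : AnalyticOnNhd ℂ f U)
    (hS : ∀ y ∈ ball (0 : E) D.α₂, ‖f y‖ ≤ D.E₀ * Real.exp (-(D.κ * D.djX)))
    {UW : Set W} (hUW : IsOpen UW) {a SH K : ℝ} (ha : 0 < a) (hballW : ball (0 : W) a ⊆ UW)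
    {H : W → E} (hH : AnalyticOnNhd ℂ H UW) (hSH : ∀ y ∈ ball (0 : W) a, ‖H y‖ ≤ SH) (hK : 0 ≤ K)
    (B : P → P → Fin 4 → W) (hB0 : ∀ x x₃, ‖B x x₃ 0‖ ≤ D.δB x) (hB1 : ∀ x x₃, ‖B x x₃ 1‖ ≤ D.normB)
    (hB2 : ∀ x x₃, ‖B x x₃ 2‖ ≤ D.normB) (hB3 : ∀ x x₃, ‖B x x₃ 3‖ ≤ D.dBΓ x x₃)
    (hδ : ∀ x, 0 ≤ D.δ₀ * D.distX x)
    (hlocx : ∀ x x₃, ∀ y ∈ ball (0 : W) a,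
      ‖fderiv ℂ H y (B x x₃ 0)‖ ≤ Real.exp (-(D.δ₀ * D.distX x)) * (K * ‖B x x₃ 0‖))
    (hlocx₃ : ∀ x x₃, ∀ y ∈ ball (0 : W) a,
      ‖fderiv ℂ H y (B x x₃ 3)‖ ≤ Real.exp (-(D.δ₀ * D.distX x₃)) * (K * ‖B x x₃ 3‖))
    (hB₃ : max SH K * (max 1 (2 * (4 : ℝ) / a)) ^ 4 ≤ D.B₃)
    (c : OrderedFinpartition 4) (hc : c.index 0 ≠ c.index 3) :
    TermEstimate286Printed D (fun x x₃ => iteratedFDeriv ℂ c.length f 0 (blockIns (𝕜 := ℂ) H 0 (B x x₃) c)) :=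
  termEstimate286_of_pointwise D _ fun x x₃ =>
    norm_iteratedFDeriv_term286_le D x x₃ hU hα hαB hball hf hS hUW ha hballW hH hSH hK (B x x₃) (hB0 x x₃)
      (hB1 x x₃) (hB2 x x₃) (hB3 x x₃) (hδ x) (hδ x₃) (hlocx x x₃) (hlocx₃ x x₃) hB₃ c hc

/-! ## §4. *"Summing over x, x₃ we get finally the following estimate"* — (4.22) for the ACTUAL expansion (4.3) of
the second sum of (4.21): the different-blocks terms derived, the same-block terms by reference -/

/-- **The second case end to end for the ACTUAL (4.3) terms**: for a different-blocks partition `c`, the printed term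
estimate (`termEstimate286_differentBlocks`), the p. 286 display (`Display286Printed`, whose right member needs (4.17),
the sizes of `B`, `δB` and the geometry behind *"δ₁ = O(M⁻¹)"* — a printed display, by reference) and the lattice
sums `c₀(δ₁) ≥ Σ_x e^{−δ₁|x−x₀|}`, `c₁(δ₁) ≥ Σ_{x₃} e^{−δ₁|x₃−x|}|x₃−x|` give
`‖Σ_{x,x₃} D^{|c|}𝐄(0)[v(c; x, x₃)]‖ ≤ (8B₃α₁α₂⁻¹)⁴ E₀ c₀ c₁ e^{−⅓κd_j(X)} (L^jη)⁵` (r20's `differentBlocks_summed_le`).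
[cite: Balaban1987RG1, p.286, (4.22)] -/
theorem differentBlocks_summed_actual [Fintype P] (D : PointData286 P)
    {U : Set E} (hU : IsOpen U) (hα : 0 < D.α₂) (hαB : D.α₂ ≤ 8 * D.B₃) (hball : ball (0 : E) D.α₂ ⊆ U)
    {f : E → F} (hf : AnalyticOnNhd ℂ f U)
    (hS : ∀ y ∈ ball (0 : E) D.α₂, ‖f y‖ ≤ D.E₀ * Real.exp (-(D.κ * D.djX)))
    {UW : Set W} (hUW : IsOpen UW) {a SH K : ℝ} (ha : 0 < a) (hballW : ball (0 : W) a ⊆ UW)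
    {H : W → E} (hH : AnalyticOnNhd ℂ H UW) (hSH : ∀ y ∈ ball (0 : W) a, ‖H y‖ ≤ SH) (hK : 0 ≤ K)
    (B : P → P → Fin 4 → W) (hB0 : ∀ x x₃, ‖B x x₃ 0‖ ≤ D.δB x) (hB1 : ∀ x x₃, ‖B x x₃ 1‖ ≤ D.normB)
    (hB2 : ∀ x x₃, ‖B x x₃ 2‖ ≤ D.normB) (hB3 : ∀ x x₃, ‖B x x₃ 3‖ ≤ D.dBΓ x x₃)
    (hδ : ∀ x, 0 ≤ D.δ₀ * D.distX x)
    (hlocx : ∀ x x₃, ∀ y ∈ ball (0 : W) a,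
      ‖fderiv ℂ H y (B x x₃ 0)‖ ≤ Real.exp (-(D.δ₀ * D.distX x)) * (K * ‖B x x₃ 0‖))
    (hlocx₃ : ∀ x x₃, ∀ y ∈ ball (0 : W) a,
      ‖fderiv ℂ H y (B x x₃ 3)‖ ≤ Real.exp (-(D.δ₀ * D.distX x₃)) * (K * ‖B x x₃ 3‖))
    (hB₃ : max SH K * (max 1 (2 * (4 : ℝ) / a)) ^ 4 ≤ D.B₃)
    (hD : Display286Printed D) {c₀ c₁ : ℝ} (hL : 0 ≤ D.Ljη) (hc₁ : 0 ≤ c₁)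
    (hsum0 : ∑ x, Real.exp (-(D.δ₁ * D.dist0 x)) ≤ c₀)
    (hsum1 : ∀ x, ∑ x₃, Real.exp (-(D.δ₁ * D.len x x₃)) * D.len x x₃ ≤ c₁)
    (c : OrderedFinpartition 4) (hc : c.index 0 ≠ c.index 3) :
    ‖∑ x, ∑ x₃, iteratedFDeriv ℂ c.length f 0 (blockIns (𝕜 := ℂ) H 0 (B x x₃) c)‖ ≤
      (8 * D.B₃ * (D.α₁ / D.α₂)) ^ 4 * D.E₀ * c₀ * c₁ * Real.exp (-(1 / 3 * D.κ * D.djX)) * D.Ljη ^ 5 := by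
  have hE₀ : 0 ≤ D.E₀ := by
    by_contra h
    push Not at h
    have h1 := hS 0 (mem_ball_self hα)
    have h2 : D.E₀ * Real.exp (-(D.κ * D.djX)) < 0 := mul_neg_of_neg_of_pos h (Real.exp_pos _)
    linarith [norm_nonneg (f 0)]
  exact differentBlocks_summed_le D _
    (termEstimate286_differentBlocks D hU hα hαB hball hf hS hUW ha hballW hH hSH hK B hB0 hB1 hB2 hB3 hδ
      hlocx hlocx₃ hB₃ c hc) hD hE₀ hL hc₁ hsum0 hsum1

/-- **(4.3) applied to the second sum of (4.21), with the `(x, x₃)`-summation outermost**: the fourth derivative of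
the composite `B ↦ 𝐄^{(j)}(X, exp iξ𝐇_j(□₀, B))` ((4.2)) at `0` on the `(x, x₃)`-localised arguments, summed over
`x, x₃`, is the sum over the partitions `c` of the four argument slots of the `(x, x₃)`-summed `c`-terms — Faà di
Bruno (pv12 `B12Repr43.faaDiBruno_apply`) and an exchange of finite sums. [cite: Balaban1987RG1, (4.3) p.281, (4.21) p.285] -/
theorem secondSum_expansion [Fintype P]
    {U : Set E} (hU : IsOpen U) {α₂ : ℝ} (hα : 0 < α₂) (hball : ball (0 : E) α₂ ⊆ U)
    {f : E → F} (hf : AnalyticOnNhd ℂ f U)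
    {UW : Set W} (hUW : IsOpen UW) {a : ℝ} (ha : 0 < a) (hballW : ball (0 : W) a ⊆ UW)
    {H : W → E} (hH : AnalyticOnNhd ℂ H UW) (hH0 : H 0 = 0) (B : P → P → Fin 4 → W) :
    ∑ x, ∑ x₃, iteratedFDeriv ℂ 4 (f ∘ H) 0 (B x x₃) =
      ∑ c : OrderedFinpartition 4, ∑ x, ∑ x₃, iteratedFDeriv ℂ c.length f 0 (blockIns (𝕜 := ℂ) H 0 (B x x₃) c) := by
  have h0 : (0 : E) ∈ U := hball (mem_ball_self hα)
  have h0W : (0 : W) ∈ UW := hballW (mem_ball_self ha)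
  have hfc : ContDiffAt ℂ ((4 : ℕ) : WithTop ℕ∞) f (H 0) := by
    rw [hH0]
    exact (hf.contDiffOn_of_completeSpace (n := 4)).contDiffAt (hU.mem_nhds h0)
  have hHc : ContDiffAt ℂ ((4 : ℕ) : WithTop ℕ∞) H 0 :=
    (hH.contDiffOn_of_completeSpace (n := 4)).contDiffAt (hUW.mem_nhds h0W)
  have hexp : ∀ x x₃, iteratedFDeriv ℂ 4 (f ∘ H) 0 (B x x₃) =
      ∑ c : OrderedFinpartition 4, iteratedFDeriv ℂ c.length f 0 (blockIns (𝕜 := ℂ) H 0 (B x x₃) c) := by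
    intro x x₃
    rw [faaDiBruno_apply hfc hHc le_rfl (B x x₃), hH0]
  calc ∑ x, ∑ x₃, iteratedFDeriv ℂ 4 (f ∘ H) 0 (B x x₃)
      = ∑ x, ∑ x₃, ∑ c : OrderedFinpartition 4,
          iteratedFDeriv ℂ c.length f 0 (blockIns (𝕜 := ℂ) H 0 (B x x₃) c) :=
        Finset.sum_congr rfl fun x _ => Finset.sum_congr rfl fun x₃ _ => hexp x x₃
    _ = ∑ x, ∑ c : OrderedFinpartition 4, ∑ x₃,
          iteratedFDeriv ℂ c.length f 0 (blockIns (𝕜 := ℂ) H 0 (B x x₃) c) :=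
        Finset.sum_congr rfl fun x _ => Finset.sum_comm
    _ = _ := Finset.sum_comm

/-- **(4.22) for the ACTUAL second sum of (4.21), the different-blocks terms DERIVED.**  *"Summing over x, x₃ we get
finally the following estimate |(the second sum in (4.21))| ≦ (32B₃ (α₁/α₂) c₀(δ₁)c₁(δ₁))⁴ exp(−⅓κd_j(X)) (L^jη)⁵
(4.22)"* — r20's decl of record `KernelBound422Printed` for `lhs2 := ‖Σ_{x,x₃} D⁴(𝐄∘𝐇)(0)[δB(x), B, B, (∂B)(Γ_{x,x₃})]‖`
(the second sum of (4.21) written through (4.2)–(4.3)), from: the DIFFERENT-BLOCKS terms of every partition — derived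
here (`differentBlocks_summed_actual`: (4.4)+(1.18), [15] Prop. 9, the (190)-shape localisation bounds, the p. 286
display, the lattice sums); the SAME-BLOCK terms — BY REFERENCE (hypothesis `hsame`: p. 286 first case, *"the
exponential factor, with a length of a shortest tree graph in the exponent, yields the factor exp(−δ₀|x₃ − x|), and the
product of it with |x₃ − x| is bounded by δ₀⁻¹"* = [15] Sect. G tree decay for several localized arguments in one
block, cell GAPS G-B11-G2a — stated as the same summed per-term bound); at most `4⁴` partition terms (pv12
`card_orderedFinpartition_le_pow`); and the bookkeeping `E₀ ≤ 1 ≤ c₀c₁` of r20's `kernelBound422_of_terms` (how `E₀`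
and the term count enter the printed constant is not displayed). [cite: Balaban1987RG1, (4.21)–(4.22) pp.285–286] -/
theorem kernelBound422_actual [Fintype P] (D : PointData286 P)
    {U : Set E} (hU : IsOpen U) (hα : 0 < D.α₂) (hαB : D.α₂ ≤ 8 * D.B₃) (hball : ball (0 : E) D.α₂ ⊆ U)
    {f : E → F} (hf : AnalyticOnNhd ℂ f U)
    (hS : ∀ y ∈ ball (0 : E) D.α₂, ‖f y‖ ≤ D.E₀ * Real.exp (-(D.κ * D.djX)))
    {UW : Set W} (hUW : IsOpen UW) {a SH K : ℝ} (ha : 0 < a) (hballW : ball (0 : W) a ⊆ UW)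
    {H : W → E} (hH : AnalyticOnNhd ℂ H UW) (hSH : ∀ y ∈ ball (0 : W) a, ‖H y‖ ≤ SH) (hH0 : H 0 = 0)
    (hK : 0 ≤ K)
    (B : P → P → Fin 4 → W) (hB0 : ∀ x x₃, ‖B x x₃ 0‖ ≤ D.δB x) (hB1 : ∀ x x₃, ‖B x x₃ 1‖ ≤ D.normB)
    (hB2 : ∀ x x₃, ‖B x x₃ 2‖ ≤ D.normB) (hB3 : ∀ x x₃, ‖B x x₃ 3‖ ≤ D.dBΓ x x₃)
    (hδ : ∀ x, 0 ≤ D.δ₀ * D.distX x)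
    (hlocx : ∀ x x₃, ∀ y ∈ ball (0 : W) a,
      ‖fderiv ℂ H y (B x x₃ 0)‖ ≤ Real.exp (-(D.δ₀ * D.distX x)) * (K * ‖B x x₃ 0‖))
    (hlocx₃ : ∀ x x₃, ∀ y ∈ ball (0 : W) a,
      ‖fderiv ℂ H y (B x x₃ 3)‖ ≤ Real.exp (-(D.δ₀ * D.distX x₃)) * (K * ‖B x x₃ 3‖))
    (hB₃ : max SH K * (max 1 (2 * (4 : ℝ) / a)) ^ 4 ≤ D.B₃)
    (hD : Display286Printed D) {c₀ c₁ : ℝ} (hL : 0 ≤ D.Ljη) (hc₁ : 0 ≤ c₁) (hE₁ : D.E₀ ≤ 1) (hcc : 1 ≤ c₀ * c₁)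
    (hsum0 : ∑ x, Real.exp (-(D.δ₁ * D.dist0 x)) ≤ c₀)
    (hsum1 : ∀ x, ∑ x₃, Real.exp (-(D.δ₁ * D.len x x₃)) * D.len x x₃ ≤ c₁)
    (hsame : ∀ c : OrderedFinpartition 4, c.index 0 = c.index 3 →
      ‖∑ x, ∑ x₃, iteratedFDeriv ℂ c.length f 0 (blockIns (𝕜 := ℂ) H 0 (B x x₃) c)‖ ≤
        (8 * D.B₃ * (D.α₁ / D.α₂)) ^ 4 * D.E₀ * c₀ * c₁ * Real.exp (-(1 / 3 * D.κ * D.djX)) * D.Ljη ^ 5) :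
    KernelBound422Printed
      ⟨‖∑ x, ∑ x₃, iteratedFDeriv ℂ 4 (f ∘ H) 0 (B x x₃)‖, D.B₃, D.α₁, D.α₂, c₀, c₁, D.κ, D.djX, D.Ljη⟩ := by
  have hE₀ : 0 ≤ D.E₀ := by
    by_contra h
    push Not at h
    have h1 := hS 0 (mem_ball_self hα)
    have h2 : D.E₀ * Real.exp (-(D.κ * D.djX)) < 0 := mul_neg_of_neg_of_pos h (Real.exp_pos _)
    linarith [norm_nonneg (f 0)]
  have hcount : (Finset.univ : Finset (OrderedFinpartition 4)).card ≤ 4 ^ 4 := by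
    rw [Finset.card_univ]
    exact card_orderedFinpartition_le_pow 4
  refine kernelBound422_of_terms _ Finset.univ hcount
    (fun c => ‖∑ x, ∑ x₃, iteratedFDeriv ℂ c.length f 0 (blockIns (𝕜 := ℂ) H 0 (B x x₃) c)‖)
    hE₀ hE₁ hcc hL ?_ ?_
  · -- (4.3) + triangle inequality over the partitions
    show ‖∑ x, ∑ x₃, iteratedFDeriv ℂ 4 (f ∘ H) 0 (B x x₃)‖ ≤ _
    rw [secondSum_expansion hU hα hball hf hUW ha hballW hH hH0 B]
    exact norm_sum_le _ _
  · intro c _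
    by_cases hc : c.index 0 = c.index 3
    · exact hsame c hc
    · exact differentBlocks_summed_actual D hU hα hαB hball hf hS hUW ha hballW hH hSH hK B hB0 hB1 hB2 hB3 hδ
        hlocx hlocx₃ hB₃ hD hL hc₁ hsum0 hsum1 c hc

/-! ## §5. The lattice-sum constants `c₀(δ₁)`, `c₁(δ₁)` of (4.22), explicit for points located on `ℤ^ν` -/

section LatticeSums

open B2Lemma25Proof

variable {ν : ℕ}

/-- **`c₀(δ₁)` explicit**: for points `x` located injectively on `ℤ^ν` (`loc`), `Σ_x e^{−δ₁|x − x₀|₁} ≤ (1 + 2/δ₁)^ν` — the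
pure decay sum over any finite set of lattice sites (`B2Lemma25Proof.sum_exp_neg_l1dist_le`, ℓ¹ distance).  Print
names this constant only through the symbol `c₀(δ₁)` in (4.22). [cite: Balaban1987RG1, (4.22) p.286] -/
theorem latticeSum_c0_le [Fintype P] (loc : P → (Fin ν → ℤ)) (hloc : Function.Injective loc) (x₀ : P)
    {δ₁ : ℝ} (hδ₁ : 0 < δ₁) :
    ∑ x, Real.exp (-(δ₁ * l1dist (loc x) (loc x₀))) ≤ (1 + 2 / δ₁) ^ ν := by
  classical
  have h := sum_exp_neg_l1dist_le hδ₁ (loc x₀) (Finset.univ.image loc)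
  rw [Finset.sum_image fun a _ b _ hab => hloc hab] at h
  calc ∑ x, Real.exp (-(δ₁ * l1dist (loc x) (loc x₀)))
      = ∑ x, Real.exp (-(δ₁ * l1dist (loc x₀) (loc x))) :=
        Finset.sum_congr rfl fun x _ => by rw [l1dist_comm]
    _ ≤ (1 + 2 / δ₁) ^ ν := h

/-- [folklore] `e^{−δ₁t}·t ≤ (2/δ₁)·e^{−δ₁t/2}` (split the exponential and use `e^{−δ₁t/2}·t ≤ (δ₁/2)⁻¹`,
r20's `sameBlock_product_le`). -/
private theorem exp_mul_self_le_exp_half {δ₁ : ℝ} (hδ₁ : 0 < δ₁) (t : ℝ) :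
    Real.exp (-(δ₁ * t)) * t ≤ 2 / δ₁ * Real.exp (-(δ₁ / 2 * t)) := by
  have h := sameBlock_product_le (half_pos hδ₁) t
  have hsplit : Real.exp (-(δ₁ * t)) = Real.exp (-(δ₁ / 2 * t)) * Real.exp (-(δ₁ / 2 * t)) := by
    rw [← Real.exp_add]
    congr 1
    ring
  rw [hsplit, mul_assoc]
  calc Real.exp (-(δ₁ / 2 * t)) * (Real.exp (-(δ₁ / 2 * t)) * t)
      ≤ Real.exp (-(δ₁ / 2 * t)) * (δ₁ / 2)⁻¹ := mul_le_mul_of_nonneg_left h (Real.exp_nonneg _)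
    _ = 2 / δ₁ * Real.exp (-(δ₁ / 2 * t)) := by rw [inv_div]; ring

/-- **`c₁(δ₁)` explicit**: for points located injectively on `ℤ^ν`, `Σ_{x₃} e^{−δ₁|x₃ − x|₁}|x₃ − x|₁ ≤ (2/δ₁)(1 + 4/δ₁)^ν`
for every `x` (one half of the decay absorbs the length: `e^{−δ₁t}t ≤ (2/δ₁)e^{−δ₁t/2}`, then the pure decay sum at
rate `δ₁/2`).  Print names this constant only through the symbol `c₁(δ₁)` in (4.22). [cite: Balaban1987RG1, (4.22) p.286] -/
theorem latticeSum_c1_le [Fintype P] (loc : P → (Fin ν → ℤ)) (hloc : Function.Injective loc) (x : P)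
    {δ₁ : ℝ} (hδ₁ : 0 < δ₁) :
    ∑ x₃, Real.exp (-(δ₁ * l1dist (loc x) (loc x₃))) * l1dist (loc x) (loc x₃) ≤
      2 / δ₁ * (1 + 4 / δ₁) ^ ν := by
  classical
  have hsum := sum_exp_neg_l1dist_le (half_pos hδ₁) (loc x) (Finset.univ.image loc)
  rw [Finset.sum_image fun a _ b _ hab => hloc hab] at hsum
  have h4 : (1 + 2 / (δ₁ / 2)) ^ ν = (1 + 4 / δ₁) ^ ν := by
    congr 1
    rw [div_div_eq_mul_div]
    ring
  calc ∑ x₃, Real.exp (-(δ₁ * l1dist (loc x) (loc x₃))) * l1dist (loc x) (loc x₃)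
      ≤ ∑ x₃, 2 / δ₁ * Real.exp (-(δ₁ / 2 * l1dist (loc x) (loc x₃))) :=
        Finset.sum_le_sum fun x₃ _ => exp_mul_self_le_exp_half hδ₁ _
    _ = 2 / δ₁ * ∑ x₃, Real.exp (-(δ₁ / 2 * l1dist (loc x) (loc x₃))) := by rw [Finset.mul_sum]
    _ ≤ 2 / δ₁ * (1 + 4 / δ₁) ^ ν := by
        rw [← h4]
        exact mul_le_mul_of_nonneg_left hsum (div_nonneg zero_le_two hδ₁.le)

/-- **(4.22) for the actual second sum with the lattice constants EXPLICIT**: `kernelBound422_actual` for points of the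
unit lattice located injectively on `ℤ^ν` (`loc`; `|x − x₀| = |loc x − loc x₀|₁`, `|x₃ − x| = |loc x − loc x₃|₁`), with
`c₀(δ₁) := (1 + 2/δ₁)^ν` and `c₁(δ₁) := (2/δ₁)(1 + 4/δ₁)^ν` (`latticeSum_c0_le`, `latticeSum_c1_le`; `1 ≤ c₀c₁` from
`δ₁ ≤ 2`, print: *"δ₁ = O(M⁻¹)"*).  Remaining by-reference inputs: the same-block terms (`hsame`, [15] Sect. G) and the
p. 286 display (`hD`). [cite: Balaban1987RG1, (4.21)–(4.22) pp.285–286] -/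
theorem kernelBound422_actual_l1 [Fintype P] (D : PointData286 P)
    (loc : P → (Fin ν → ℤ)) (hloc : Function.Injective loc)
    (hdist0 : ∀ x, D.dist0 x = l1dist (loc x) (loc D.x₀)) (hlen : ∀ x x₃, D.len x x₃ = l1dist (loc x) (loc x₃))
    (hδ₁ : 0 < D.δ₁) (hδ₁2 : D.δ₁ ≤ 2)
    {U : Set E} (hU : IsOpen U) (hα : 0 < D.α₂) (hαB : D.α₂ ≤ 8 * D.B₃) (hball : ball (0 : E) D.α₂ ⊆ U)
    {f : E → F} (hf : AnalyticOnNhd ℂ f U)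
    (hS : ∀ y ∈ ball (0 : E) D.α₂, ‖f y‖ ≤ D.E₀ * Real.exp (-(D.κ * D.djX)))
    {UW : Set W} (hUW : IsOpen UW) {a SH K : ℝ} (ha : 0 < a) (hballW : ball (0 : W) a ⊆ UW)
    {H : W → E} (hH : AnalyticOnNhd ℂ H UW) (hSH : ∀ y ∈ ball (0 : W) a, ‖H y‖ ≤ SH) (hH0 : H 0 = 0)
    (hK : 0 ≤ K)
    (B : P → P → Fin 4 → W) (hB0 : ∀ x x₃, ‖B x x₃ 0‖ ≤ D.δB x) (hB1 : ∀ x x₃, ‖B x x₃ 1‖ ≤ D.normB)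
    (hB2 : ∀ x x₃, ‖B x x₃ 2‖ ≤ D.normB) (hB3 : ∀ x x₃, ‖B x x₃ 3‖ ≤ D.dBΓ x x₃)
    (hδ : ∀ x, 0 ≤ D.δ₀ * D.distX x)
    (hlocx : ∀ x x₃, ∀ y ∈ ball (0 : W) a,
      ‖fderiv ℂ H y (B x x₃ 0)‖ ≤ Real.exp (-(D.δ₀ * D.distX x)) * (K * ‖B x x₃ 0‖))
    (hlocx₃ : ∀ x x₃, ∀ y ∈ ball (0 : W) a,
      ‖fderiv ℂ H y (B x x₃ 3)‖ ≤ Real.exp (-(D.δ₀ * D.distX x₃)) * (K * ‖B x x₃ 3‖))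
    (hB₃ : max SH K * (max 1 (2 * (4 : ℝ) / a)) ^ 4 ≤ D.B₃)
    (hD : Display286Printed D) (hL : 0 ≤ D.Ljη) (hE₁ : D.E₀ ≤ 1)
    (hsame : ∀ c : OrderedFinpartition 4, c.index 0 = c.index 3 →
      ‖∑ x, ∑ x₃, iteratedFDeriv ℂ c.length f 0 (blockIns (𝕜 := ℂ) H 0 (B x x₃) c)‖ ≤
        (8 * D.B₃ * (D.α₁ / D.α₂)) ^ 4 * D.E₀ * (1 + 2 / D.δ₁) ^ ν * (2 / D.δ₁ * (1 + 4 / D.δ₁) ^ ν) *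
          Real.exp (-(1 / 3 * D.κ * D.djX)) * D.Ljη ^ 5) :
    KernelBound422Printed
      ⟨‖∑ x, ∑ x₃, iteratedFDeriv ℂ 4 (f ∘ H) 0 (B x x₃)‖, D.B₃, D.α₁, D.α₂,
        (1 + 2 / D.δ₁) ^ ν, 2 / D.δ₁ * (1 + 4 / D.δ₁) ^ ν, D.κ, D.djX, D.Ljη⟩ := by
  have hc₀1 : 1 ≤ (1 + 2 / D.δ₁) ^ ν :=
    one_le_pow₀ (by linarith [div_nonneg zero_le_two hδ₁.le] : (1 : ℝ) ≤ 1 + 2 / D.δ₁)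
  have hc₁1 : 1 ≤ 2 / D.δ₁ * (1 + 4 / D.δ₁) ^ ν :=
    one_le_mul_of_one_le_of_one_le ((one_le_div hδ₁).2 hδ₁2)
      (one_le_pow₀ (by linarith [div_nonneg (by norm_num : (0:ℝ) ≤ 4) hδ₁.le] : (1 : ℝ) ≤ 1 + 4 / D.δ₁))
  have hcc : 1 ≤ (1 + 2 / D.δ₁) ^ ν * (2 / D.δ₁ * (1 + 4 / D.δ₁) ^ ν) :=
    one_le_mul_of_one_le_of_one_le hc₀1 hc₁1
  have hc₁ : 0 ≤ 2 / D.δ₁ * (1 + 4 / D.δ₁) ^ ν := zero_le_one.trans hc₁1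
  have hsum0 : ∑ x, Real.exp (-(D.δ₁ * D.dist0 x)) ≤ (1 + 2 / D.δ₁) ^ ν := by
    simp_rw [hdist0]
    exact latticeSum_c0_le loc hloc D.x₀ hδ₁
  have hsum1 : ∀ x, ∑ x₃, Real.exp (-(D.δ₁ * D.len x x₃)) * D.len x x₃ ≤ 2 / D.δ₁ * (1 + 4 / D.δ₁) ^ ν := by
    intro x
    simp_rw [hlen]
    exact latticeSum_c1_le loc hloc x hδ₁
  exact kernelBound422_actual D hU hα hαB hball hf hS hUW ha hballW hH hSH hH0 hK B hB0 hB1 hB2 hB3 hδ hlocx hlocx₃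
    hB₃ hD hL hc₁ hE₁ hcc hsum0 hsum1 hsame

end LatticeSums

end Literature.MathematicalPhysics.QuantumFieldTheory.Balaban1983to89.B12Term286DifferentBlocks

end
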